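/-
Copyright (c) 2026. Released under Apache 2.0 license.
-/
import Literature.Computability.StringMatching.SuffixArray
import HarnessLib

/-!
# Detection of squares: the Main–Lorentz test and Crochemore's f-factorisation test

Source: M. Crochemore, C. Hancart, T. Lecroq, *Algorithms on Strings*, Cambridge University Press
(2007), §9.3 "Detection of squares", paragraph "Existence of a square" — Lemma 9.10, Corollary 9.11,
Proposition 9.12, the f-factorisation, Lemma 9.13, Theorem 9.14 — with the tables of Figure 9.7, and the
Notes of Chapter 9 (the divide-and-conquer test and `ltest` are due to Main and Lorentz; the test
`Square-in` through the f-factorisation to Crochemore [Crochemore1986]). [CrochemoreHancartLecroq2007]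

A *square occurrence* `IsSquareOcc y k l` is a factor `y[k..k+2l) = ww` with `|w| = l ≥ 1`; its *centre*
is `k + l`.  For `y = u · v` the occurrence is *centred on `u`* when `k + l ≤ |u|` and *centred on `v`*
otherwise (the book's predicates `ltest(u, v)` / `rtest(u, v)`).  `IsSquareFree y` says that `y` has no
square occurrence (equivalently, no factor `ww` with `w ≠ ε`: `isSquareFree_iff_forall_infix`).

Dictionary with the tables of §9.3 ("Computation of centered squares"):
`suff_u[i-1] = |lcsuff(u, u[0..i))| = (lcs u (u.take i)).length` (`lcs`, the longest common suffix, is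
the mirror image of `lcp` of the table of prefixes), `p_{v,u}[i] = |lcp(v, u[i..))| =
(lcp v (u.drop i)).length`, and `pref_v[j] = pref v j`.

## Main statements

* `exists_isSquareOcc_centred_left_iff` — **Lemma 9.10** (Main–Lorentz): for square-free `u`, `u · v`
  contains a square centred on `u` iff `suff_u[i-1] + p_{v,u}[i] ≥ |u| - i` for some position `i` on
  `u`.  The "if" half `exists_isSquareOcc_of_le_lcs_add_lcp` needs no hypothesis and produces a square
  of period `|u| - i`; the "only if" half `IsSquareOcc.le_lcs_add_lcp` needs `u` square-free (the
  example following the lemma, `u = aab`, `v = c`, shows that this hypothesis cannot be dropped).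
* `exists_isSquareOcc_centred_right_iff` — the mirror statement deciding `rtest(u, v)` for square-free
  `v` from `pref_v` and `|lcsuff(u, v[0..j))|` (the tables behind Corollary 9.11).
* `exists_isSquareOcc_append_iff` — **Proposition 9.12** (the correctness core of `Rec-square-in`):
  for square-free `u` and `v`, `u · v` contains a square iff one of the two tests passes;
  `exists_isSquareOcc_append_iff_of_meets` is the divide step (a square of `u · v` lies in `u`, in
  `v`, or meets both).
* the tables of **Figure 9.7** (`u = cabacbabcbac`, `v = babcbab`): `suff_u`, `p_{v,u}`, the two
  passing positions `5` and `9`, and the four squares centred on `u`, by `decide`.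
* `prevLen`, `fPos`, `fFactor`, `fFactorization` — the **f-factorisation** `⟨u_0, u_1, …, u_k⟩` of
  `y` (`u_0 = y[0]`; `u_j` is the longest prefix `w` of the rest of `y` occurring at least twice in
  `u_0 ⋯ u_{j-1} w`, or the next letter when `w = ε`), with `le_prevLen` (maximality) and the example
  `abaabbaabbaabaab ↦ ⟨a, b, a, ab, baabbaab, aab⟩` computed by `decide`.
* `exists_isSquareOcc_iff_fFactorization` — **Lemma 9.13** (Crochemore): `y` contains a square iff
  for some index `0 < j ≤ k`, (1) `u_j` has an earlier occurrence overlapping or adjacent to it, or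
  (2) `u_{j-1} u_j` contains a square, or (3) `j > 1` and `u_0 ⋯ u_j` contains a square centred on
  `u_{j-1} u_j`.  The "only if" half `exists_fFactor_cond_of_isSquareOcc` (least `j` with a square in
  `u_0 ⋯ u_j`, maximality of `u_{j-1}`) lands in (2) or (3); `isSquareFree_iff_fFactorization` is the
  form returned by the algorithm `Square-in` (**Theorem 9.14**), and `isSquareFree_fFactor` is the
  remark of the proof keeping the arguments of `ltest` / `rtest` square-free along the scan.

## Deviations

* Condition 1 of Lemma 9.13 is stated with *an* earlier occurrence `p < |u_0 ⋯ u_{j-1}|` of `u_j`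
  with `|u_0 ⋯ u_{j-1}| ≤ p + |u_j|`, rather than with the first occurrence `pos_y(u_j)`; the book's
  condition is the instance `p = pos_y(u_j)`, and either form gives the equivalence.
* The running-time statements (Corollary 9.11, the `O(n log n)` bound for `Rec-square-in`,
  Theorem 9.14) and the computation of the f-factorisation by the suffix automaton are not formalised.
-/

namespace Literature.Combinatorics.Words

open List Nat
open Literature.Computability.StringMatching (lcp pref lcp_prefix_left lcp_prefix_right
  length_lcp_le_left length_lcp_le_right getElem?_eq_of_lt_length_lcp take_prefix_iff_le_length_lcp)

variable {α : Type*} [DecidableEq α]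

/-! ### Square occurrences and square-free words -/

/-- `IsSquareOcc y k l`: the factor `y[k..k+2l)` of `y` is a square `ww` with `|w| = l ≥ 1`
("a square `w²` occurring at position `k` on `y`").
[cite: CrochemoreHancartLecroq2007, §9.3 (Existence of a square)] -/
def IsSquareOcc (y : List α) (k l : ℕ) : Prop :=
  0 < l ∧ k + 2 * l ≤ y.length ∧ (y.drop k).take l = (y.drop (k + l)).take l

/-- Square occurrences are decidable (the windows are compared letter by letter). [folklore] -/
instance (y : List α) (k l : ℕ) : Decidable (IsSquareOcc y k l) := by
  unfold IsSquareOcc; infer_instance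

/-- A word is **square-free** (squarefree) if none of its factors is a nonempty square.
[cite: CrochemoreHancartLecroq2007, §9.3 (Detection of squares)] -/
def IsSquareFree (y : List α) : Prop := ∀ k l : ℕ, ¬ IsSquareOcc y k l

omit [DecidableEq α] in
/-- Letter form of a square occurrence. [cite: CrochemoreHancartLecroq2007, §9.3 (Existence of a square)] -/
theorem isSquareOcc_iff {y : List α} {k l : ℕ} :
    IsSquareOcc y k l ↔ 0 < l ∧ k + 2 * l ≤ y.length ∧ ∀ m < l, y[k + m]? = y[k + l + m]? := by
  unfold IsSquareOcc
  refine and_congr_right fun _ => and_congr_right fun _ => ⟨fun h m hm => ?_, fun h => ?_⟩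
  · have e := congrArg (fun t : List α => t[m]?) h
    simpa only [List.getElem?_take, if_pos hm, List.getElem?_drop] using e
  · refine List.ext_getElem? fun m => ?_
    simp only [List.getElem?_take, List.getElem?_drop]
    split_ifs with hm
    · exact h m hm
    · rfl

omit [DecidableEq α] in
/-- The bounded form of square-freeness (whence decidability).
[cite: CrochemoreHancartLecroq2007, §9.3 (Detection of squares)] -/
theorem isSquareFree_iff {y : List α} :
    IsSquareFree y ↔ ∀ k < y.length, ∀ l < y.length, ¬ IsSquareOcc y k l := by
  refine ⟨fun h k _ l _ => h k l, fun h k l hkl => ?_⟩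
  have := hkl.1; have := hkl.2.1
  exact h k (by omega) l (by omega) hkl

/-- Square-freeness is decidable (finitely many windows, `isSquareFree_iff`). [folklore] -/
instance (y : List α) : Decidable (IsSquareFree y) := decidable_of_iff' _ isSquareFree_iff

omit [DecidableEq α] in
/-- A square occurrence exhibits the factor `ww`, `w = y[k..k+l) ≠ ε`.
[cite: CrochemoreHancartLecroq2007, §9.3 (Existence of a square)] -/
theorem IsSquareOcc.append_infix {y : List α} {k l : ℕ} (h : IsSquareOcc y k l) :
    (y.drop k).take l ++ (y.drop k).take l <:+: y ∧ (y.drop k).take l ≠ [] := by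
  obtain ⟨hl, hkl, heq⟩ := h
  refine ⟨?_, fun h0 => ?_⟩
  · rw [show (y.drop k).take l ++ (y.drop k).take l = (y.drop k).take (l + l) by
      rw [List.take_add, List.drop_drop, heq]]
    exact (List.take_prefix _ _).isInfix.trans (List.drop_suffix k y).isInfix
  · have := congrArg List.length h0
    rw [List.length_take, List.length_drop, List.length_nil] at this
    omega

omit [DecidableEq α] in
/-- Conversely a factor `ww`, `w ≠ ε`, is a square occurrence.
[cite: CrochemoreHancartLecroq2007, §9.3 (Existence of a square)] -/
theorem exists_isSquareOcc_of_infix {y w : List α} (hw : w ≠ []) (h : w ++ w <:+: y) :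
    ∃ k, IsSquareOcc y k w.length := by
  obtain ⟨s, t, rfl⟩ := h
  refine ⟨s.length, List.length_pos_of_ne_nil hw, by simp; omega, ?_⟩
  rw [List.append_assoc, List.append_assoc, List.drop_left, List.take_left, ← List.append_assoc,
    List.drop_left' (by simp), List.take_left]

omit [DecidableEq α] in
/-- Square-freeness in terms of factors. [cite: CrochemoreHancartLecroq2007, §9.3 (Detection of squares)] -/
theorem isSquareFree_iff_forall_infix {y : List α} :
    IsSquareFree y ↔ ∀ w : List α, w ≠ [] → ¬ (w ++ w <:+: y) := by
  constructor
  · intro h w hw hwy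
    obtain ⟨k, hk⟩ := exists_isSquareOcc_of_infix hw hwy
    exact h k _ hk
  · intro h k l hkl
    obtain ⟨h1, h2⟩ := hkl.append_infix
    exact h _ h2 h1

omit [DecidableEq α] in
/-- A square occurrence inside the left factor of `u · v`. [cite: CrochemoreHancartLecroq2007, §9.3 (Existence of a square)] -/
theorem IsSquareOcc.of_append_left {u v : List α} {k l : ℕ} (h : IsSquareOcc (u ++ v) k l)
    (hkl : k + 2 * l ≤ u.length) : IsSquareOcc u k l := by
  rw [isSquareOcc_iff] at h ⊢
  refine ⟨h.1, hkl, fun m hm => ?_⟩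
  have e := h.2.2 m hm
  rwa [List.getElem?_append_left (by omega), List.getElem?_append_left (by omega)] at e

omit [DecidableEq α] in
/-- A square occurrence of `u` is one of `u · v`. [cite: CrochemoreHancartLecroq2007, §9.3 (Existence of a square)] -/
theorem IsSquareOcc.append_right {u : List α} (v : List α) {k l : ℕ} (h : IsSquareOcc u k l) :
    IsSquareOcc (u ++ v) k l := by
  rw [isSquareOcc_iff] at h ⊢
  refine ⟨h.1, by simp; omega, fun m hm => ?_⟩
  rw [List.getElem?_append_left (by omega), List.getElem?_append_left (by omega)]
  exact h.2.2 m hm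

omit [DecidableEq α] in
/-- A square occurrence inside the right factor of `u · v`. [cite: CrochemoreHancartLecroq2007, §9.3 (Existence of a square)] -/
theorem IsSquareOcc.of_append_right {u v : List α} {k l : ℕ} (h : IsSquareOcc (u ++ v) k l)
    (hk : u.length ≤ k) : IsSquareOcc v (k - u.length) l := by
  rw [isSquareOcc_iff] at h ⊢
  obtain ⟨h1, h2, h3⟩ := h
  refine ⟨h1, by simp at h2; omega, fun m hm => ?_⟩
  have e := h3 m hm
  rwa [List.getElem?_append_right (by omega), List.getElem?_append_right (by omega),
    show k + m - u.length = k - u.length + m by omega,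
    show k + l + m - u.length = k - u.length + l + m by omega] at e

omit [DecidableEq α] in
/-- A square occurrence of `v` is one of `u · v` (shifted by `|u|`). [cite: CrochemoreHancartLecroq2007, §9.3 (Existence of a square)] -/
theorem IsSquareOcc.append_left (u : List α) {v : List α} {k l : ℕ} (h : IsSquareOcc v k l) :
    IsSquareOcc (u ++ v) (u.length + k) l := by
  rw [isSquareOcc_iff] at h ⊢
  obtain ⟨h1, h2, h3⟩ := h
  refine ⟨h1, by simp; omega, fun m hm => ?_⟩
  rw [List.getElem?_append_right (by omega), List.getElem?_append_right (by omega),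
    show u.length + k + m - u.length = k + m by omega,
    show u.length + k + l + m - u.length = k + l + m by omega]
  exact h3 m hm

/-! ### Longest common suffix -/

omit [DecidableEq α] in
/-- Two words agreeing on their first `m` letters have the same `m`-prefix. [folklore] -/
private theorem take_eq_take_of_getElem?_eq {u v : List α} {m : ℕ}
    (h : ∀ j < m, u[j]? = v[j]?) : u.take m = v.take m :=
  List.ext_getElem? fun j => by
    simp only [List.getElem?_take]
    split_ifs with hj
    · exact h j hj
    · rfl

/-- A common prefix of length `m` (letterwise) bounds `|lcp(u, v)|` from below. [folklore] -/
private theorem le_length_lcp_of_forall_getElem?_eq {u v : List α} {m : ℕ} (hmv : m ≤ v.length)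
    (h : ∀ j < m, u[j]? = v[j]?) : m ≤ (lcp u v).length := by
  rw [← take_prefix_iff_le_length_lcp hmv, ← take_eq_take_of_getElem?_eq h]
  exact List.take_prefix m u

/-- `lcs u v = lcsuff(u, v)`, the longest common suffix of `u` and `v`.
[cite: CrochemoreHancartLecroq2007, §9.3 (Computation of centered squares: table suff)] -/
def lcs (u v : List α) : List α := (lcp u.reverse v.reverse).reverse

/-- `|lcs(u, v)| = |lcp(u~, v~)|`. [cite: CrochemoreHancartLecroq2007, §9.3 (Computation of centered squares)] -/
@[simp] theorem length_lcs (u v : List α) : (lcs u v).length = (lcp u.reverse v.reverse).length := by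
  simp [lcs]

/-- `lcs(u, v)` is a suffix of `u`. [cite: CrochemoreHancartLecroq2007, §9.3 (Computation of centered squares)] -/
theorem lcs_suffix_left (u v : List α) : lcs u v <:+ u := by
  have h := (lcp_prefix_left u.reverse v.reverse).reverse
  rwa [List.reverse_reverse] at h

/-- `lcs(u, v)` is a suffix of `v`. [cite: CrochemoreHancartLecroq2007, §9.3 (Computation of centered squares)] -/
theorem lcs_suffix_right (u v : List α) : lcs u v <:+ v := by
  have h := (lcp_prefix_right u.reverse v.reverse).reverse
  rwa [List.reverse_reverse] at h

/-- `|lcs(u, v)| ≤ |u|`. [cite: CrochemoreHancartLecroq2007, §9.3 (Computation of centered squares)] -/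
theorem length_lcs_le_left (u v : List α) : (lcs u v).length ≤ u.length :=
  (lcs_suffix_left u v).length_le

/-- `|lcs(u, v)| ≤ |v|`. [cite: CrochemoreHancartLecroq2007, §9.3 (Computation of centered squares)] -/
theorem length_lcs_le_right (u v : List α) : (lcs u v).length ≤ v.length :=
  (lcs_suffix_right u v).length_le

/-- Inside the longest common suffix the letters agree (counted from the right).
[cite: CrochemoreHancartLecroq2007, §9.3 (Computation of centered squares)] -/
theorem getElem?_eq_of_lt_length_lcs {u v : List α} {j : ℕ} (hj : j < (lcs u v).length) :
    u[u.length - 1 - j]? = v[v.length - 1 - j]? := by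
  rw [length_lcs] at hj
  have hju : j < u.length := by
    have := length_lcp_le_left u.reverse v.reverse; rw [List.length_reverse] at this; omega
  have hjv : j < v.length := by
    have := length_lcp_le_right u.reverse v.reverse; rw [List.length_reverse] at this; omega
  have e := getElem?_eq_of_lt_length_lcp hj
  rwa [List.getElem?_reverse hju, List.getElem?_reverse hjv] at e

/-- A common suffix of length `m` (letterwise) bounds `|lcs(u, v)|` from below.
[cite: CrochemoreHancartLecroq2007, §9.3 (Computation of centered squares)] -/
theorem le_length_lcs_of_getElem?_eq {u v : List α} {m : ℕ} (hmu : m ≤ u.length) (hmv : m ≤ v.length)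
    (h : ∀ j < m, u[u.length - 1 - j]? = v[v.length - 1 - j]?) : m ≤ (lcs u v).length := by
  rw [length_lcs]
  refine le_length_lcp_of_forall_getElem?_eq (by simpa using hmv) fun j hj => ?_
  rw [List.getElem?_reverse (by omega), List.getElem?_reverse (by omega)]
  exact h j hj

/-! ### Lemma 9.10: squares of `u · v` centred on `u` (Main–Lorentz) -/

/-- **Lemma 9.10, "if" (no hypothesis on `u`).** If for some position `i` on `u`,
`suff_u[i-1] + p_{v,u}[i] ≥ |u| - i`, i.e. `|lcsuff(u, u[0..i))| + |lcp(v, u[i..))| ≥ |u| - i`, then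
`u · v` contains a square `ww` centred on `u` (an occurrence at `k` with `k + |w| ≤ |u|`), namely one with
`|w| = |u| - i`. [cite: CrochemoreHancartLecroq2007, §9.3 Lemma 9.10] -/
theorem exists_isSquareOcc_of_le_lcs_add_lcp {u v : List α} {i : ℕ} (hi : i < u.length)
    (h : u.length - i ≤ (lcs u (u.take i)).length + (lcp v (u.drop i)).length) :
    ∃ k, k + (u.length - i) ≤ u.length ∧ IsSquareOcc (u ++ v) k (u.length - i) := by
  set a := (lcs u (u.take i)).length with ha
  set b := (lcp v (u.drop i)).length with hb
  have hai : a ≤ i := by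
    have := length_lcs_le_right u (u.take i); rw [List.length_take] at this; omega
  have hbv : b ≤ v.length := length_lcp_le_left v (u.drop i)
  have hbu : b ≤ u.length - i := by
    have := length_lcp_le_right v (u.drop i); rw [List.length_drop] at this; omega
  -- centre `c := max i (|u| - a)`, start `k := c - (|u| - i)`
  set c := max i (u.length - a) with hc
  refine ⟨c - (u.length - i), by omega, ?_⟩
  rw [isSquareOcc_iff]
  refine ⟨by omega, by rw [List.length_append]; omega, fun m hm => ?_⟩
  rw [show c - (u.length - i) + (u.length - i) + m = c + m by omega]
  rcases Nat.lt_or_ge m (u.length - c) with hm1 | hm1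
  · -- first part: a letter of the common suffix `u[c..|u|) = u[k..i)`
    rw [List.getElem?_append_left (by omega), List.getElem?_append_left (by omega)]
    have e := getElem?_eq_of_lt_length_lcs (u := u) (v := u.take i) (j := u.length - c - 1 - m)
      (by rw [← ha]; omega)
    rw [List.length_take, Nat.min_eq_left hi.le, List.getElem?_take, if_pos (by omega)] at e
    rw [show c - (u.length - i) + m = i - 1 - (u.length - c - 1 - m) by omega,
      show c + m = u.length - 1 - (u.length - c - 1 - m) by omega]
    exact e.symm
  · -- second part: a letter of the common prefix of `v` and `u[i..)`
    rw [List.getElem?_append_left (by omega), List.getElem?_append_right (by omega)]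
    have e := getElem?_eq_of_lt_length_lcp (u := v) (v := u.drop i) (j := c + m - u.length)
      (by rw [← hb]; omega)
    rw [List.getElem?_drop, show i + (c + m - u.length) = c - (u.length - i) + m by omega] at e
    exact e.symm

/-- **Lemma 9.10, "only if" (`u` square-free).** If `u` is square-free and `u · v` contains a square
`ww` centred on `u` (an occurrence at `k` with `|w| = l`, `k + l ≤ |u|`), then for the position
`i = k + |u| - (k + l)` on `u` one has `suff_u[i-1] + p_{v,u}[i] ≥ |u| - i`.
[cite: CrochemoreHancartLecroq2007, §9.3 Lemma 9.10] -/
theorem IsSquareOcc.le_lcs_add_lcp {u v : List α} {k l : ℕ} (hu : IsSquareFree u)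
    (h : IsSquareOcc (u ++ v) k l) (hc : k + l ≤ u.length) :
    ∃ i < u.length, u.length - i ≤ (lcs u (u.take i)).length + (lcp v (u.drop i)).length := by
  -- the square is not inside `u`
  have h2 : u.length < k + 2 * l := by
    by_contra h2
    exact hu k l (h.of_append_left (by omega))
  have h' := h
  rw [isSquareOcc_iff] at h'
  obtain ⟨hl, hkl, heq⟩ := h'
  rw [List.length_append] at hkl
  refine ⟨k + (u.length - (k + l)), by omega, ?_⟩
  have ea : u.length - (k + l) ≤ (lcs u (u.take (k + (u.length - (k + l))))).length := by
    refine le_length_lcs_of_getElem?_eq (by omega) (by rw [List.length_take]; omega) fun j hj => ?_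
    rw [List.length_take, Nat.min_eq_left (by omega), List.getElem?_take, if_pos (by omega)]
    have e := heq (u.length - 1 - j - (k + l)) (by omega)
    rw [List.getElem?_append_left (by omega), List.getElem?_append_left (by omega),
      show k + l + (u.length - 1 - j - (k + l)) = u.length - 1 - j by omega,
      show k + (u.length - 1 - j - (k + l)) = k + (u.length - (k + l)) - 1 - j by omega] at e
    exact e.symm
  have eb : k + 2 * l - u.length ≤ (lcp v (u.drop (k + (u.length - (k + l))))).length := by
    refine le_length_lcp_of_forall_getElem?_eq (by rw [List.length_drop]; omega) fun n hn => ?_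
    rw [List.getElem?_drop]
    have e := heq (u.length - (k + l) + n) (by omega)
    rw [List.getElem?_append_left (by omega), List.getElem?_append_right (by omega),
      show k + l + (u.length - (k + l) + n) - u.length = n by omega,
      show k + (u.length - (k + l) + n) = k + (u.length - (k + l)) + n by omega] at e
    exact e.symm
  omega

/-- **Lemma 9.10 (Main–Lorentz).** Let `u` be square-free. Then `u · v` contains a square centred
on `u` if and only if for some position `i` on `u`, `suff_u[i-1] + p_{v,u}[i] ≥ |u| - i`, where
`suff_u[i-1] = |lcsuff(u, u[0..i))|` and `p_{v,u}[i] = |lcp(v, u[i..|u|))|`.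
[cite: CrochemoreHancartLecroq2007, §9.3 Lemma 9.10] -/
theorem exists_isSquareOcc_centred_left_iff {u v : List α} (hu : IsSquareFree u) :
    (∃ k l, IsSquareOcc (u ++ v) k l ∧ k + l ≤ u.length) ↔
      ∃ i < u.length, u.length - i ≤ (lcs u (u.take i)).length + (lcp v (u.drop i)).length := by
  constructor
  · rintro ⟨k, l, h, hc⟩
    exact h.le_lcs_add_lcp hu hc
  · rintro ⟨i, hi, h⟩
    obtain ⟨k, hk, hsq⟩ := exists_isSquareOcc_of_le_lcs_add_lcp hi h
    exact ⟨k, _, hsq, hk⟩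

/-- The hypothesis "`u` square-free" cannot be dropped in Lemma 9.10: `u = aab`, `v = c`
(`u · v` has the square `aa` centred on `u`, but no position passes the test).
[cite: CrochemoreHancartLecroq2007, §9.3 Lemma 9.10] -/
example : (∃ k l, IsSquareOcc ([0, 0, 1] ++ [2] : List ℕ) k l ∧ k + l ≤ 3) ∧
    ¬ ∃ i < 3, 3 - i ≤ (lcs [0, 0, 1] (([0, 0, 1] : List ℕ).take i)).length +
      (lcp [2] (([0, 0, 1] : List ℕ).drop i)).length :=
  ⟨⟨0, 1, by decide, by decide⟩, by decide⟩


/-! ### The mirror image: squares of `u · v` centred on `v` -/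

open Literature.Computability.StringMatching (getElem?_eq_of_lt_pref pref_le_length_sub
  take_drop_prefix_iff_le_pref)

/-- **Mirror of Lemma 9.10, "if" (no hypothesis).** If for some `0 < j < |v|`, `pref_v[j] ≥ 1` and
`pref_v[j] + |lcsuff(u, v[0..j))| ≥ j`, then `u · v` contains a square centred on `v` (an occurrence
at `k` with `|w| = j` and `k + |w| > |u|`). [cite: CrochemoreHancartLecroq2007, §9.3 Lemma 9.10 & Corollary 9.11 (computation of rtest)] -/
theorem exists_isSquareOcc_of_le_pref_add_lcs {u v : List α} {j : ℕ} (hj : 0 < j) (hjv : j < v.length)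
    (hp : 0 < pref v j) (h : j ≤ pref v j + (lcs u (v.take j)).length) :
    ∃ k, u.length < k + j ∧ IsSquareOcc (u ++ v) k j := by
  set p := pref v j with hpdef
  set a := (lcs u (v.take j)).length with ha
  have hpv : p ≤ v.length - j := pref_le_length_sub v j
  have hau : a ≤ u.length := length_lcs_le_left u (v.take j)
  have haj : a ≤ j := by
    have := length_lcs_le_right u (v.take j); rw [List.length_take] at this; omega
  -- `q := min p j` letters of the square lie in `v` before the centre; start `k := |u| + q - j`
  set q := min p j with hq
  refine ⟨u.length + q - j, by omega, ?_⟩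
  rw [isSquareOcc_iff]
  refine ⟨hj, by rw [List.length_append]; omega, fun m hm => ?_⟩
  have er : (u ++ v)[u.length + q - j + j + m]? = v[q + m]? := by
    rw [show u.length + q - j + j + m = u.length + (q + m) by omega,
      List.getElem?_append_right (by omega), Nat.add_sub_cancel_left]
  rw [er]
  rcases Nat.lt_or_ge m (j - q) with hm1 | hm1
  · -- a letter of the common suffix of `u` and `v[0..j)`
    rw [List.getElem?_append_left (by omega)]
    have e := getElem?_eq_of_lt_length_lcs (u := u) (v := v.take j) (j := j - q - 1 - m)
      (by rw [← ha]; omega)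
    rw [List.length_take, Nat.min_eq_left hjv.le, List.getElem?_take, if_pos (by omega)] at e
    rw [show u.length + q - j + m = u.length - 1 - (j - q - 1 - m) by omega,
      show q + m = j - 1 - (j - q - 1 - m) by omega]
    exact e
  · -- a letter of the prefix of `v` occurring at position `j`
    rw [List.getElem?_append_right (by omega)]
    have e := getElem?_eq_of_lt_pref (x := v) (k := j) (j := q + m - j) (by rw [← hpdef]; omega)
    rw [show j + (q + m - j) = q + m by omega] at e
    rw [show u.length + q - j + m - u.length = q + m - j by omega]
    exact e.symm

/-- **Mirror of Lemma 9.10, "only if" (`v` square-free).** If `v` is square-free and `u · v` contains a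
square centred on `v` (an occurrence at `k` with `|w| = l`, `k + l > |u|`), then `j = l` satisfies
`0 < j < |v|`, `pref_v[j] ≥ 1` and `pref_v[j] + |lcsuff(u, v[0..j))| ≥ j`.
[cite: CrochemoreHancartLecroq2007, §9.3 Lemma 9.10 & Corollary 9.11 (computation of rtest)] -/
theorem IsSquareOcc.le_pref_add_lcs {u v : List α} {k l : ℕ} (hv : IsSquareFree v)
    (h : IsSquareOcc (u ++ v) k l) (hc : u.length < k + l) :
    0 < l ∧ l < v.length ∧ 0 < pref v l ∧ l ≤ pref v l + (lcs u (v.take l)).length := by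
  -- the square is not inside `v`
  have h2 : k < u.length := by
    by_contra h2
    exact hv _ l (h.of_append_right (by omega))
  have h' := h
  rw [isSquareOcc_iff] at h'
  obtain ⟨hl, hkl, heq⟩ := h'
  rw [List.length_append] at hkl
  have hp : k + l - u.length ≤ pref v l := by
    rw [← take_drop_prefix_iff_le_pref (by omega)]
    rw [show (v.drop l).take (k + l - u.length) = v.take (k + l - u.length) from
      take_eq_take_of_getElem?_eq fun n hn => ?_]
    · exact List.take_prefix _ _
    rw [List.getElem?_drop]
    have e := heq (u.length - k + n) (by omega)
    rw [List.getElem?_append_right (by omega), List.getElem?_append_right (by omega),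
      show k + (u.length - k + n) - u.length = n by omega,
      show k + l + (u.length - k + n) - u.length = l + n by omega] at e
    exact e.symm
  have ha : u.length - k ≤ (lcs u (v.take l)).length := by
    refine le_length_lcs_of_getElem?_eq (by omega) (by rw [List.length_take]; omega) fun r hr => ?_
    rw [List.length_take, Nat.min_eq_left (by omega), List.getElem?_take, if_pos (by omega)]
    have e := heq (u.length - k - 1 - r) (by omega)
    rw [List.getElem?_append_left (by omega), List.getElem?_append_right (by omega),
      show k + (u.length - k - 1 - r) = u.length - 1 - r by omega,
      show k + l + (u.length - k - 1 - r) - u.length = l - 1 - r by omega] at e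
    exact e
  exact ⟨hl, by omega, by omega, by omega⟩

/-- **Mirror of Lemma 9.10.** Let `v` be square-free. Then `u · v` contains a square centred on `v`
iff for some `0 < j < |v|`: `pref_v[j] ≥ 1` and `pref_v[j] + |lcsuff(u, v[0..j))| ≥ j` (the test
behind `rtest`, computed from the table of prefixes of `v` and the analogue of `p_{v,u}` for suffixes).
[cite: CrochemoreHancartLecroq2007, §9.3 Lemma 9.10 & Corollary 9.11 (computation of rtest)] -/
theorem exists_isSquareOcc_centred_right_iff {u v : List α} (hv : IsSquareFree v) :
    (∃ k l, IsSquareOcc (u ++ v) k l ∧ u.length < k + l) ↔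
      ∃ j, 0 < j ∧ j < v.length ∧ 0 < pref v j ∧ j ≤ pref v j + (lcs u (v.take j)).length := by
  constructor
  · rintro ⟨k, l, h, hc⟩
    exact ⟨l, h.le_pref_add_lcs hv hc⟩
  · rintro ⟨j, hj, hjv, hp, h⟩
    obtain ⟨k, hk, hsq⟩ := exists_isSquareOcc_of_le_pref_add_lcs hj hjv hp h
    exact ⟨k, j, hsq, hk⟩

/-! ### Proposition 9.12: squares of a concatenation of two square-free words -/

/-- Every square of `u · v` lies in `u`, lies in `v`, or is centred on `u` or on `v` while meeting
both; hence for square-free `u` and `v`, **`u · v` contains a square iff `ltest(u, v)` or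
`rtest(u, v)` holds** — the correctness invariant of `Rec-square-in` (Proposition 9.12), with both
tests in the table form of Lemma 9.10 / Corollary 9.11.
[cite: CrochemoreHancartLecroq2007, §9.3 Proposition 9.12] -/
theorem exists_isSquareOcc_append_iff {u v : List α} (hu : IsSquareFree u) (hv : IsSquareFree v) :
    (∃ k l, IsSquareOcc (u ++ v) k l) ↔
      (∃ i < u.length, u.length - i ≤ (lcs u (u.take i)).length + (lcp v (u.drop i)).length) ∨
      (∃ j, 0 < j ∧ j < v.length ∧ 0 < pref v j ∧ j ≤ pref v j + (lcs u (v.take j)).length) := by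
  rw [← exists_isSquareOcc_centred_left_iff hu, ← exists_isSquareOcc_centred_right_iff hv]
  constructor
  · rintro ⟨k, l, h⟩
    rcases Nat.lt_or_ge u.length (k + l) with hc | hc
    · exact Or.inr ⟨k, l, h, hc⟩
    · exact Or.inl ⟨k, l, h, hc⟩
  · rintro (⟨k, l, h, -⟩ | ⟨k, l, h, -⟩) <;> exact ⟨k, l, h⟩

omit [DecidableEq α] in
/-- The divide step of `Rec-square-in`: `u · v` contains a square iff `u` does, `v` does, or
`u · v` has a square meeting both `u` and `v`. [cite: CrochemoreHancartLecroq2007, §9.3 Proposition 9.12] -/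
theorem exists_isSquareOcc_append_iff_of_meets {u v : List α} :
    (∃ k l, IsSquareOcc (u ++ v) k l) ↔ (∃ k l, IsSquareOcc u k l) ∨ (∃ k l, IsSquareOcc v k l) ∨
      ∃ k l, IsSquareOcc (u ++ v) k l ∧ k < u.length ∧ u.length < k + 2 * l := by
  constructor
  · rintro ⟨k, l, h⟩
    by_cases h1 : k + 2 * l ≤ u.length
    · exact Or.inl ⟨k, l, h.of_append_left h1⟩
    by_cases h2 : u.length ≤ k
    · exact Or.inr (Or.inl ⟨_, l, h.of_append_right h2⟩)
    exact Or.inr (Or.inr ⟨k, l, h, by omega, by omega⟩)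
  · rintro (⟨k, l, h⟩ | ⟨k, l, h⟩ | ⟨k, l, h, -⟩)
    · exact ⟨k, l, h.append_right v⟩
    · exact ⟨_, l, h.append_left u⟩
    · exact ⟨k, l, h⟩

/-! ### The example of Figure 9.7 -/

section Example

/-- `u = cabacbabcbac` over `{a, b, c} = {0, 1, 2}`. [cite: CrochemoreHancartLecroq2007, §9.3 Fig. 9.7] -/
private def exU : List ℕ := [2, 0, 1, 0, 2, 1, 0, 1, 2, 1, 0, 2]
/-- `v = babcbab`. [cite: CrochemoreHancartLecroq2007, §9.3 Fig. 9.7] -/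
private def exV : List ℕ := [1, 0, 1, 2, 1, 0, 1]

/-- The table `suff_u` of Fig. 9.7: `suff_u[i] = |lcsuff(u, u[0..i])|`.
[cite: CrochemoreHancartLecroq2007, §9.3 Fig. 9.7] -/
example : (List.range 12).map (fun i => (lcs exU (exU.take (i + 1))).length) =
    [1, 0, 0, 0, 3, 0, 0, 0, 1, 0, 0, 12] := by decide

/-- The table `p_{v,u}` of Fig. 9.7: `p_{v,u}[j] = |lcp(v, u[j..])|`.
[cite: CrochemoreHancartLecroq2007, §9.3 Fig. 9.7] -/
example : (List.range 12).map (fun j => (lcp exV (exU.drop j)).length) =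
    [0, 0, 2, 0, 0, 6, 0, 1, 0, 2, 0, 0] := by decide

/-- The positions passing the test of Lemma 9.10 are `i = 5` (`suff_u[4] + p_{v,u}[5] = 9 ≥ 7`, the
squares `(bacbabc)²`, `(acbabcb)²`, `(cbabcba)²` of period `7 = |u| - 5`) and `i = 9`
(`suff_u[8] + p_{v,u}[9] = 3 ≥ 3`, the square `(cba)²`). [cite: CrochemoreHancartLecroq2007, §9.3 Fig. 9.7] -/
example : (List.range 12).filter (fun i => 12 - i ≤ (lcs exU (exU.take i)).length +
    (lcp exV (exU.drop i)).length) = [5, 9] := by decide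

/-- … and indeed `u · v` has exactly the four squares centred on `u` listed in Fig. 9.7, at positions
`2, 3, 4` (period `7`) and `8` (period `3`). [cite: CrochemoreHancartLecroq2007, §9.3 Fig. 9.7] -/
example : ((List.range 19).flatMap fun k => (List.range 10).filterMap fun l =>
    if IsSquareOcc (exU ++ exV) k l ∧ k + l ≤ 12 then some (k, l) else none) =
    [(2, 7), (3, 7), (4, 7), (8, 3)] := by decide

end Example


/-! ### Squares of factors -/

omit [DecidableEq α] in
/-- A square occurrence of the factor `y[a..a+b)` is one of `y` (shifted by `a`).
[cite: CrochemoreHancartLecroq2007, §9.3 Lemma 9.13 (proof)] -/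
theorem IsSquareOcc.of_drop_take {y : List α} {a b k l : ℕ} (h : IsSquareOcc ((y.drop a).take b) k l) :
    IsSquareOcc y (a + k) l := by
  rw [isSquareOcc_iff] at h ⊢
  obtain ⟨h1, h2, h3⟩ := h
  rw [List.length_take, List.length_drop] at h2
  refine ⟨h1, by omega, fun m hm => ?_⟩
  have e := h3 m hm
  rwa [List.getElem?_take, if_pos (by omega), List.getElem?_take, if_pos (by omega),
    List.getElem?_drop, List.getElem?_drop, show a + (k + m) = a + k + m by omega,
    show a + (k + l + m) = a + k + l + m by omega] at e

omit [DecidableEq α] in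
/-- A square occurrence of `y` inside `[a, a + b)` is one of the factor `y[a..a+b)`.
[cite: CrochemoreHancartLecroq2007, §9.3 Lemma 9.13 (proof)] -/
theorem IsSquareOcc.drop_take {y : List α} {a b k l : ℕ} (h : IsSquareOcc y k l) (hak : a ≤ k)
    (hkb : k + 2 * l ≤ a + b) : IsSquareOcc ((y.drop a).take b) (k - a) l := by
  rw [isSquareOcc_iff] at h ⊢
  obtain ⟨h1, h2, h3⟩ := h
  refine ⟨h1, by rw [List.length_take, List.length_drop]; omega, fun m hm => ?_⟩
  rw [List.getElem?_take, if_pos (by omega), List.getElem?_take, if_pos (by omega),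
    List.getElem?_drop, List.getElem?_drop, show a + (k - a + m) = k + m by omega,
    show a + (k - a + l + m) = k + l + m by omega]
  exact h3 m hm

omit [DecidableEq α] in
/-- Two occurrences of the same nonempty word at distance at most its length yield a square
(used for Condition 1 of Lemma 9.13). [cite: CrochemoreHancartLecroq2007, §9.3 Lemma 9.13 (proof, Condition 1)] -/
theorem isSquareOcc_of_overlap {y : List α} {p i n : ℕ} (hpi : p < i) (hin : i + n ≤ y.length)
    (hip : i ≤ p + n) (h : (y.drop p).take n = (y.drop i).take n) : IsSquareOcc y p (i - p) := by
  rw [isSquareOcc_iff]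
  refine ⟨by omega, by omega, fun m hm => ?_⟩
  have e := congrArg (fun t : List α => t[m]?) h
  simp only [List.getElem?_take, if_pos (show m < n by omega), List.getElem?_drop] at e
  rwa [show p + (i - p) + m = i + m by omega]

/-! ### The f-factorisation -/

/-- `HasEarlierOcc y i n`: the prefix of length `n` of `y[i..)` has an occurrence in `y` starting at a
position `p < i` — i.e. it "occurs at least twice in `y[0..i) · y[i..i+n)`".
[cite: CrochemoreHancartLecroq2007, §9.3 (f-factorization)] -/
def HasEarlierOcc (y : List α) (i n : ℕ) : Prop := ∃ p < i, (y.drop p).take n = (y.drop i).take n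

/-- An earlier occurrence is decidable (bounded existential). [folklore] -/
instance (y : List α) (i n : ℕ) : Decidable (HasEarlierOcc y i n) := by
  unfold HasEarlierOcc; infer_instance

/-- `prevLen y i`: the length of the longest prefix `w` of `y[i..)` that occurs at least twice in
`y[0..i) · w`. [cite: CrochemoreHancartLecroq2007, §9.3 (f-factorization)] -/
def prevLen (y : List α) (i : ℕ) : ℕ := Nat.findGreatest (HasEarlierOcc y i) (y.length - i)

/-- The cut following position `i` in the f-factorisation: the factor starting at `i` is `w` if
`w ≠ ε` and the letter `y[i]` otherwise. [cite: CrochemoreHancartLecroq2007, §9.3 (f-factorization)] -/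
def fNext (y : List α) (i : ℕ) : ℕ := i + max 1 (prevLen y i)

/-- `fPos y j`: the starting position of the `j`-th factor `u_j` of the f-factorisation
`⟨u_0, u_1, …, u_k⟩` of `y` (and `≥ |y|` for `j > k`). [cite: CrochemoreHancartLecroq2007, §9.3 (f-factorization)] -/
def fPos (y : List α) : ℕ → ℕ
  | 0 => 0
  | j + 1 => fNext y (fPos y j)

/-- The `j`-th factor `u_j = y[fPos j .. fPos (j+1))` of the f-factorisation.
[cite: CrochemoreHancartLecroq2007, §9.3 (f-factorization)] -/
def fFactor (y : List α) (j : ℕ) : List α := (y.drop (fPos y j)).take (fPos y (j + 1) - fPos y j)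

/-- The f-factorisation `⟨u_0, u_1, …, u_k⟩` of `y` as a list of factors.
[cite: CrochemoreHancartLecroq2007, §9.3 (f-factorization)] -/
def fFactorization (y : List α) : List (List α) :=
  ((List.range y.length).filter fun j => fPos y j < y.length).map (fFactor y)

/-- The f-factorisation of `y = abaabbaabbaabaab` is `⟨a, b, a, ab, baabbaab, aab⟩` (computed from the
definition; cf. the example following the definition in the book).
[cite: CrochemoreHancartLecroq2007, §9.3 (f-factorization, example)] -/
example : fFactorization ([0,1,0,0,1,1,0,0,1,1,0,0,1,0,0,1] : List ℕ) =
    [[0], [1], [0], [0, 1], [1, 0, 0, 1, 1, 0, 0, 1], [0, 0, 1]] := by decide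

/-- The first factor starts at position `0`. [cite: CrochemoreHancartLecroq2007, §9.3 (f-factorization)] -/
@[simp] theorem fPos_zero (y : List α) : fPos y 0 = 0 := rfl

/-- `fPos (j+1) = fPos j + max 1 (prevLen (fPos j))`. [cite: CrochemoreHancartLecroq2007, §9.3 (f-factorization)] -/
theorem fPos_succ (y : List α) (j : ℕ) : fPos y (j + 1) = fPos y j + max 1 (prevLen y (fPos y j)) := rfl

/-- `prevLen y i ≤ |y| - i`. [cite: CrochemoreHancartLecroq2007, §9.3 (f-factorization)] -/
theorem prevLen_le (y : List α) (i : ℕ) : prevLen y i ≤ y.length - i := Nat.findGreatest_le _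

/-- No earlier occurrence before position `0`: `prevLen y 0 = 0`, so `u_0 = y[0]`.
[cite: CrochemoreHancartLecroq2007, §9.3 (f-factorization)] -/
@[simp] theorem prevLen_zero (y : List α) : prevLen y 0 = 0 := by
  rw [prevLen, Nat.findGreatest_eq_zero_iff]
  rintro n - - ⟨p, hp, -⟩
  exact Nat.not_lt_zero p hp

/-- `fPos 1 = 1`: the first factor is the first letter. [cite: CrochemoreHancartLecroq2007, §9.3 (f-factorization)] -/
@[simp] theorem fPos_one (y : List α) : fPos y 1 = 1 := by
  simp [fPos_succ]

/-- The positions are strictly increasing. [cite: CrochemoreHancartLecroq2007, §9.3 (f-factorization)] -/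
theorem fPos_lt_fPos_succ (y : List α) (j : ℕ) : fPos y j < fPos y (j + 1) := by
  rw [fPos_succ]; omega

/-- `j ≤ fPos j`. [cite: CrochemoreHancartLecroq2007, §9.3 (f-factorization)] -/
theorem le_fPos (y : List α) : ∀ j, j ≤ fPos y j
  | 0 => le_rfl
  | j + 1 => by have := le_fPos y j; have := fPos_lt_fPos_succ y j; omega

/-- The positions are monotone. [cite: CrochemoreHancartLecroq2007, §9.3 (f-factorization)] -/
theorem fPos_mono (y : List α) {i j : ℕ} (hij : i ≤ j) : fPos y i ≤ fPos y j := by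
  induction hij with
  | refl => exact le_rfl
  | step _ ih => exact ih.trans (fPos_lt_fPos_succ y _).le

/-- A factor that starts inside `y` ends inside `y`. [cite: CrochemoreHancartLecroq2007, §9.3 (f-factorization)] -/
theorem fPos_succ_le_length {y : List α} {j : ℕ} (hj : fPos y j < y.length) : fPos y (j + 1) ≤ y.length := by
  rw [fPos_succ]; have := prevLen_le y (fPos y j); omega

/-- An earlier occurrence of a prefix of `y[i..)` of length `n` forces `prevLen y i ≥ n`
(maximality of the factors). [cite: CrochemoreHancartLecroq2007, §9.3 (f-factorization)] -/
theorem le_prevLen {y : List α} {i n : ℕ} (hn : i + n ≤ y.length) (h : HasEarlierOcc y i n) :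
    n ≤ prevLen y i :=
  Nat.le_findGreatest (by omega) h

/-- `u_{j-1} · u_j = y[fPos (j-1) .. fPos (j+1))`. [cite: CrochemoreHancartLecroq2007, §9.3 (f-factorization)] -/
theorem fFactor_append_fFactor (y : List α) {j : ℕ} (hj : 0 < j) :
    fFactor y (j - 1) ++ fFactor y j = (y.drop (fPos y (j - 1))).take (fPos y (j + 1) - fPos y (j - 1)) := by
  obtain ⟨i, rfl⟩ : ∃ i, j = i + 1 := ⟨j - 1, by omega⟩
  simp only [Nat.add_sub_cancel, fFactor]
  have h1 := fPos_lt_fPos_succ y i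
  have h2 := fPos_lt_fPos_succ y (i + 1)
  rw [show fPos y (i + 1 + 1) - fPos y i = (fPos y (i + 1) - fPos y i) + (fPos y (i + 1 + 1) - fPos y (i + 1))
    by omega, List.take_add, List.drop_drop, show fPos y i + (fPos y (i + 1) - fPos y i) = fPos y (i + 1) by omega]

/-! ### Lemma 9.13 (Crochemore): square-freeness read off the f-factorisation -/

/-- **Lemma 9.13, "only if".** If `y` contains a square then for some index `0 < j ≤ k` of its
f-factorisation `⟨u_0, …, u_k⟩`, either `u_{j-1} u_j` contains a square (Condition 2:
`ltest(u_{j-1}, u_j)` or `rtest(u_{j-1}, u_j)`), or `j > 1` and `u_0 ⋯ u_j` contains a square centred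
on `u_{j-1} u_j` (Condition 3: `rtest(u_0 ⋯ u_{j-2}, u_{j-1} u_j)`).  The proof takes the least `j`
with a square inside `u_0 ⋯ u_j` and uses the maximality of `u_{j-1}`.
[cite: CrochemoreHancartLecroq2007, §9.3 Lemma 9.13] -/
theorem exists_fFactor_cond_of_isSquareOcc {y : List α} {k l : ℕ} (h : IsSquareOcc y k l) :
    ∃ j, 0 < j ∧ fPos y j < y.length ∧
      ((∃ k' l', IsSquareOcc (fFactor y (j - 1) ++ fFactor y j) k' l') ∨
       (1 < j ∧ ∃ k' l', IsSquareOcc (y.take (fPos y (j + 1))) k' l' ∧ fPos y (j - 1) < k' + l')) := by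
  classical
  have hex : ∃ j, ∃ k l, IsSquareOcc y k l ∧ k + 2 * l ≤ fPos y (j + 1) :=
    ⟨y.length, k, l, h, h.2.1.trans ((le_fPos y _).trans (fPos_lt_fPos_succ y _).le)⟩
  set j := Nat.find hex with hjdef
  obtain ⟨k, l, hk, hkl⟩ : ∃ k l, IsSquareOcc y k l ∧ k + 2 * l ≤ fPos y (j + 1) := Nat.find_spec hex
  have hmin : ∀ j' < j, ¬ ∃ k l, IsSquareOcc y k l ∧ k + 2 * l ≤ fPos y (j' + 1) := fun j' hj' =>
    Nat.find_min hex hj'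
  have hk' := hk
  rw [isSquareOcc_iff] at hk'
  obtain ⟨hl, hkly, heq⟩ := hk'
  have hj0 : 0 < j := by
    rcases Nat.eq_zero_or_pos j with h0 | h0
    · rw [h0, fPos_one] at hkl; omega
    · exact h0
  -- the square is not inside `u_0 ⋯ u_{j-1} = y[0 .. fPos j)`
  have hs : fPos y j < k + 2 * l := by
    by_contra hs
    exact hmin (j - 1) (by omega) ⟨k, l, hk, by rw [Nat.sub_add_cancel hj0]; omega⟩
  have hsy : fPos y j < y.length := by omega
  have hs' : fPos y (j + 1) ≤ y.length := fPos_succ_le_length hsy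
  have hstep : fPos y j = fPos y (j - 1) + max 1 (prevLen y (fPos y (j - 1))) := by
    conv_lhs => rw [← Nat.sub_add_cancel hj0, fPos_succ]
  refine ⟨j, hj0, hsy, ?_⟩
  by_cases h1 : fPos y (j - 1) ≤ k
  · -- the square lies inside `u_{j-1} u_j`
    refine Or.inl ⟨k - fPos y (j - 1), l, ?_⟩
    rw [fFactor_append_fFactor y hj0]
    exact hk.drop_take h1 (by omega)
  by_cases h2 : fPos y (j - 1) < k + l
  · -- the square is centred on `u_{j-1} u_j`
    refine Or.inr ⟨?_, k, l, ?_, h2⟩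
    · by_contra hj1
      have : j = 1 := by omega
      rw [this] at h1; simp at h1
    · have := hk.drop_take (a := 0) (b := fPos y (j + 1)) (Nat.zero_le _) (by omega)
      simpa using this
  · -- impossible: the second half of the square covers `u_{j-1}` and more, contradicting maximality
    exfalso
    have hocc : HasEarlierOcc y (fPos y (j - 1)) (k + 2 * l - fPos y (j - 1)) := by
      refine ⟨fPos y (j - 1) - l, by omega, take_eq_take_of_getElem?_eq fun m hm => ?_⟩
      rw [List.getElem?_drop, List.getElem?_drop]
      have e := heq (fPos y (j - 1) - l - k + m) (by omega)
      rwa [show k + (fPos y (j - 1) - l - k + m) = fPos y (j - 1) - l + m by omega,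
        show k + l + (fPos y (j - 1) - l - k + m) = fPos y (j - 1) + m by omega] at e
    have := le_prevLen (by omega) hocc
    omega

/-- **Lemma 9.13, "if".** Each of the three conditions exhibits a square of `y`: (1) an earlier
occurrence of `u_j` at `p < fPos j` overlapping or adjacent to it (`fPos j ≤ p + |u_j|`); (2) a square
in `u_{j-1} u_j`; (3) a square in `u_0 ⋯ u_j` (centred on `u_{j-1} u_j`).
[cite: CrochemoreHancartLecroq2007, §9.3 Lemma 9.13] -/
theorem exists_isSquareOcc_of_fFactor_cond {y : List α} {j : ℕ} (hj : 0 < j) (hjy : fPos y j < y.length)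
    (h : (∃ p < fPos y j, (y.drop p).take (fPos y (j + 1) - fPos y j) = fFactor y j ∧
            fPos y j ≤ p + (fPos y (j + 1) - fPos y j)) ∨
      (∃ k l, IsSquareOcc (fFactor y (j - 1) ++ fFactor y j) k l) ∨
      (1 < j ∧ ∃ k l, IsSquareOcc (y.take (fPos y (j + 1))) k l ∧ fPos y (j - 1) < k + l)) :
    ∃ k l, IsSquareOcc y k l := by
  have hs' := fPos_succ_le_length hjy
  rcases h with ⟨p, hp, hocc, hov⟩ | ⟨k, l, hk⟩ | ⟨-, k, l, hk, -⟩
  · exact ⟨p, _, isSquareOcc_of_overlap hp (by omega) hov hocc⟩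
  · rw [fFactor_append_fFactor y hj] at hk
    exact ⟨_, l, hk.of_drop_take⟩
  · have := hk.of_drop_take (y := y) (a := 0) (b := fPos y (j + 1)) (k := k) (l := l)
    exact ⟨_, l, by simpa using this⟩

/-- **Lemma 9.13 (Crochemore).** Let `⟨u_0, u_1, …, u_k⟩` be the f-factorisation of `y`. Then `y`
contains a square iff for some index `0 < j ≤ k` (i.e. `fPos j < |y|`) one of the following holds:
(1) `u_j` has an earlier occurrence at a position `p < fPos j` with `fPos j ≤ p + |u_j|` (for the first
occurrence `pos_y(u_j)` this is the book's `|u_0 ⋯ u_{j-1}| ≤ pos_y(u_j) + |u_j| < |u_0 ⋯ u_j|`);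
(2) `u_{j-1} u_j` contains a square (`ltest(u_{j-1}, u_j)` or `rtest(u_{j-1}, u_j)`);
(3) `j > 1` and `u_0 ⋯ u_j` contains a square centred on `u_{j-1} u_j` (`rtest(u_0 ⋯ u_{j-2}, u_{j-1} u_j)`).
This is the correctness of the linear-time test `Square-in` (Theorem 9.14).
[cite: CrochemoreHancartLecroq2007, §9.3 Lemma 9.13 & Theorem 9.14] -/
theorem exists_isSquareOcc_iff_fFactorization (y : List α) :
    (∃ k l, IsSquareOcc y k l) ↔ ∃ j, 0 < j ∧ fPos y j < y.length ∧
      ((∃ p < fPos y j, (y.drop p).take (fPos y (j + 1) - fPos y j) = fFactor y j ∧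
            fPos y j ≤ p + (fPos y (j + 1) - fPos y j)) ∨
       (∃ k l, IsSquareOcc (fFactor y (j - 1) ++ fFactor y j) k l) ∨
       (1 < j ∧ ∃ k l, IsSquareOcc (y.take (fPos y (j + 1))) k l ∧ fPos y (j - 1) < k + l)) := by
  constructor
  · rintro ⟨k, l, h⟩
    obtain ⟨j, hj, hjy, hc⟩ := exists_fFactor_cond_of_isSquareOcc h
    exact ⟨j, hj, hjy, Or.inr hc⟩
  · rintro ⟨j, hj, hjy, h⟩
    exact exists_isSquareOcc_of_fFactor_cond hj hjy h

/-- Square-freeness read off the f-factorisation (contrapositive packaging of Lemma 9.13, the form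
returned by `Square-in`). [cite: CrochemoreHancartLecroq2007, §9.3 Lemma 9.13 & Theorem 9.14] -/
theorem isSquareFree_iff_fFactorization (y : List α) :
    IsSquareFree y ↔ ∀ j, 0 < j → fPos y j < y.length →
      (∀ p < fPos y j, (y.drop p).take (fPos y (j + 1) - fPos y j) = fFactor y j →
          p + (fPos y (j + 1) - fPos y j) < fPos y j) ∧
      IsSquareFree (fFactor y (j - 1) ++ fFactor y j) ∧
      (1 < j → ∀ k l, IsSquareOcc (y.take (fPos y (j + 1))) k l → k + l ≤ fPos y (j - 1)) := by
  have key := exists_isSquareOcc_iff_fFactorization y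
  constructor
  · intro hy j hj hjy
    have hno : ¬ ∃ k l, IsSquareOcc y k l := fun ⟨k, l, hk⟩ => hy k l hk
    rw [key] at hno
    push Not at hno
    obtain ⟨h1, h2, h3⟩ := hno j hj hjy
    exact ⟨fun p hp hocc => h1 p hp hocc, fun k l hk => h2 k l hk, fun hj1 k l hk => h3 hj1 k l hk⟩
  · intro h k l hk
    obtain ⟨j, hj, hjy, hc⟩ := exists_fFactor_cond_of_isSquareOcc hk
    obtain ⟨h1, h2, h3⟩ := h j hj hjy
    rcases hc with ⟨k', l', hk'⟩ | ⟨hj1, k', l', hk', hlt⟩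
    · exact h2 k' l' hk'
    · have := h3 hj1 k' l' hk'
      omega

/-- The remark in the proof of Lemma 9.13 that makes `ltest` / `rtest` (Lemma 9.10, which needs
square-free arguments) applicable along `Square-in`: if `u_0 ⋯ u_{j-1}` is square-free and Condition 1
fails at `j`, then `u_j` is square-free — it is a single letter, or a factor of `u_0 ⋯ u_{j-1}`.
[cite: CrochemoreHancartLecroq2007, §9.3 Lemma 9.13 (proof)] -/
theorem isSquareFree_fFactor {y : List α} {j : ℕ} (hj : 0 < j)
    (hP : IsSquareFree (y.take (fPos y j)))
    (h1 : ∀ p < fPos y j, (y.drop p).take (fPos y (j + 1) - fPos y j) = fFactor y j →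
      p + (fPos y (j + 1) - fPos y j) < fPos y j) :
    IsSquareFree (fFactor y j) := by
  intro k l hk
  have hn : fPos y (j + 1) - fPos y j = max 1 (prevLen y (fPos y j)) := by rw [fPos_succ]; omega
  have hlen := hk.2.1
  have hl := hk.1
  rw [fFactor, List.length_take, hn] at hlen
  rcases Nat.eq_zero_or_pos (prevLen y (fPos y j)) with h0 | hpos
  · -- `u_j` is a single letter
    rw [h0] at hlen; omega
  · -- `u_j` occurs earlier, hence (Condition 1 failing) inside `u_0 ⋯ u_{j-1}`
    have hs : 0 < fPos y j := by have := le_fPos y j; omega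
    have hspec : HasEarlierOcc y (fPos y j) (prevLen y (fPos y j)) :=
      Nat.findGreatest_spec (P := HasEarlierOcc y (fPos y j)) (Nat.zero_le _) ⟨0, hs, by simp⟩
    obtain ⟨p, hp, hocc⟩ := hspec
    have hn' : fPos y (j + 1) - fPos y j = prevLen y (fPos y j) := by rw [hn]; omega
    rw [← hn'] at hocc
    have hlt := h1 p hp hocc
    rw [fFactor, ← hocc] at hk
    have h2 := (hk.of_drop_take).drop_take (a := 0) (b := fPos y j) (Nat.zero_le _) (by omega)
    simp only [List.drop_zero, Nat.sub_zero] at h2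
    exact hP _ _ h2

/-- Example: `y = abaabbaabbaabaab` contains a square (e.g. `aa` at position `2`), detected at `j = 3`
by Condition 2 (`u_2 u_3 = a · ab` contains `aa`). [cite: CrochemoreHancartLecroq2007, §9.3 Lemma 9.13 (example)] -/
example : ∃ k l, IsSquareOcc (fFactor ([0,1,0,0,1,1,0,0,1,1,0,0,1,0,0,1] : List ℕ) 2 ++
    fFactor ([0,1,0,0,1,1,0,0,1,1,0,0,1,0,0,1] : List ℕ) 3) k l := ⟨0, 1, by decide⟩

/-- Example: the square-free word `abcacbabcbac` (so that all three tests fail at every index of its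
f-factorisation `⟨a, b, c, a, c, b, abc, ba, c⟩`). [cite: CrochemoreHancartLecroq2007, §9.3 Lemma 9.13] -/
example : fFactorization ([0,1,2,0,2,1,0,1,2,1,0,2] : List ℕ) =
    [[0], [1], [2], [0], [2], [1], [0, 1, 2], [1, 0], [2]] ∧
    IsSquareFree ([0,1,2,0,2,1,0,1,2,1,0,2] : List ℕ) := by
  constructor
  · decide
  · decide

end Literature.Combinatorics.Words
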